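import Summits.AtomisticToContinuum.Crystallization.Theses.DisclinationRation
import Summits.AtomisticToContinuum.Crystallization.Theorems.BarlowLiouville.Negative.GroundStateLoadBearing

/-!
# Disproof of `BarlowLiouville` — findings (crux stmt-AtomisticToContinuum-15801, route `DisclinationRation`, K3)

Standing crux-disprover work file (seat `refuter-cdisprove-stmt-AtomisticToContinuum-15801-0`, cycle 1,
2026-08-17).  Prose only in docstrings.  INDEX OF FINDINGS:

1. STRUCTURE (`barlowLiouville_iff`, `not_barlowLiouville_iff`, `barlowLiouville_of_not_stability`):
   the crux is `UniformPolytypeStability → Core` (`Iff.rfl`).  A refutation `¬ BarlowLiouville` is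
   EQUIVALENT to `UniformPolytypeStability ∧ ¬ Core`: it would have to PROVE K4 (crux 15800, certified
   numerics) — out of a refuter's reach — and if K4 is false the crux is vacuously TRUE.  So the only
   attackable object is `Core`, and `¬ Core` needs a Lennard-Jones ground-state sequence WITH an
   everywhere-good templated relatively dense hull element `X` — i.e. most of the crystal problem (K1 + K2 +
   HullGlue of this very route).  VERDICT: no cheap kill exists; the crux resists for the RIGHT reason
   (its hypotheses can only be instantiated by solving the upstream cruxes), not because it is robustly true.
2. LOAD-BEARING (`core_false_without_groundState`, LANDED as
   `Theorems/BarlowLiouville/Negative/GroundStateLoadBearing.lean`, p167480): `Core` with the ground-state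
   hypothesis deleted is FALSE — witness the enumerated fcc packing of balls of diameter `2`
   (`fccStacking 2 (2√(2/3))`): `2`-separated, relatively dense, its own hull element, EXACTLY good at every
   point, Barlow-templated by `Φ = 2 • ·`, and yet with NO layered window in the box `a ∈ [47/50, 1]`
   (radius `4`, tolerance `1/10`).  MESSAGE: every geometric hypothesis of the crux is scale-free (`δ`
   arbitrary, goodness dilation-invariant, template scale `l_p` free); the conclusion's box is an absolute
   scale.  Any proof must pin the nearest-neighbour distance of `X` from `IsGroundState` — in the picked line
   `Sketch` this is exactly where `hullBulkOptimal_proof` (12090) + `crysEnergyLimit_proof` (0626) enter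
   `stub_price`/`density_of_price`; a proof of `stub_price` that does not use `2 e⋆` quantitatively is wrong.
3. REDUNDANT HYPOTHESIS (`core_iff_noTemplate`): given the PROVED sibling crux `RobustBarlowTemplate`
   (12088, `robustBarlowTemplate_proof`), the template hypothesis of `Core` is implied by the others
   (`X ≠ ∅` from relative density, `δ`-separation, pointwise goodness): `Core ↔ CoreNoTemplate`.  Provers
   may use the template freely but it carries no information beyond C.
4. NOT LOAD-TESTABLE: `UniformPolytypeStability` (see 1), the hull clause `HL`, relative density and
   `δ`-separation cannot be deleted-and-refuted cheaply — every such variant still quantifies over GROUND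
   STATES, whose structure is the open problem.  (Relative density + everywhere-goodness exclude boundary
   hull elements; without relative density a half-crystal limit would be a plausible but unconstructible
   witness.)
5. LINE `Sketch` (lead prover-line-…-15801-0; `Lines/Sketch.lean`): stubs `stub_pigeonhole`,
   `stub_uniformSpacing`, `stub_transfer` are LANDED (`Theorems/DisclinationRationBarlowLiouvilleStub*.lean`,
   sorry-free) and I could not fault them (checked on paper: pigeonhole needs only finiteness of balls ∩ X,
   given by `δ`-separation; uniform spacing is compactness of `[47/50,1]` + exact dilation covariance of the
   box; transfer is two triangle inequalities).  JOINT SUFFICIENCY holds by `BarlowLiouville_of` (rc 0).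
   The whole crux therefore rests on `stub_price` (XL): a LOCAL energy–strain inequality on the 1/20-tube,
   `c·#bad(R,η) − C(L+1)² ≤ Σ_{y∈X∩B_L} Σ'_{z≠y} V(|y−z|) − 2e⋆·#(X∩B_L)`, constants depending on
   `(X, R, η)`, for EVERY everywhere-good templated relatively dense separated `X` (no hull, no ground
   state).  ATTACKS ON `stub_price` (all survive): (a) wrong-scale packings `F_l` (all points bad when
   `|l − a|R ≳ η`): priced, excess `2(e(l) − e⋆) > 0` per site, e.g. `l = 2`: `≈ +1.39`/site; `l = 1`:
   `≈ +0.037`; `l = 0.94`: `≈ +0.068` (Blanc–Lewin units ×12); (b) slowly modulated / bent everywhere-good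
   crystals: badness at `y` forces strain `≳ η/R` somewhere in `B_R(y)`, linear elasticity + K4 price it at
   `≳ κ(η/R)²` per `R³` bad points — consistent with `c = c(X,R,η)`; (c) coherent fcc/hcp intergrowths and
   arbitrary stacking words are LAYERED (good), so the `1e-4` polytype energy scale never has to be
   resolved by `stub_price`; (d) junk: the `tsum`s are summable for separated `X` (`r⁻⁶` tails), `e⋆` is a
   genuine infimum (`bddBelow_energyPerParticle_lennardJones`), `L < 0` and small balls are absorbed by
   `C(L+1)²` and by `E_self(n pts) ≥ n·e∞ = n·e⋆` (0626) — no sign error found.  The ONLY way to break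
   `stub_price` is an everywhere-good, templated structure with ZERO excess energy density and a positive
   density of `(R,η)`-non-layered points (a "static breather"/incommensurate shuffle at no cost); none is
   known for Lennard-Jones in 3-D, and K4 forbids it infinitesimally.  Its hypotheses "relatively dense" and
   "δ-separated" look UNNECESSARY for truth (dropping them only adds configurations with positive excess or
   empty balls) — information for the lead, not a flaw.
6. NEAR-MISSES / NEXT REGIMES: (i) a UNIFORM price (`c, C` independent of `X`) is a natural strengthening
   I could neither prove nor refute — smooth modulations suggest it is true with `c ~ κ η²/R⁵`; (ii) the
   "frequently in `N`" of the conclusion cannot be upgraded to "eventually" without using that ALL `x N` are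
   ground states (different `N` may select different polytypes/orientations — harmless here since `A, s, z`
   are chosen per `N`).

## Census
Tried: direct kill — impossible modulo K4 (finding 1); junk audit of `IsGroundState`/`lennardJones`/box —
clean (LJ min at `r = 1`, `−1/12`; relaxed spacing `0.9712 ∈ [47/50,1]`; increments `≈0.793 ∈ [0.757,0.825]`);
GS-deletion — REFUTED (landed); template-deletion — redundant (proved iff); stub attacks — 3 landed stubs
sound, `stub_price` survives (a)–(d).
-/

noncomputable section

namespace Summit.AtomisticToContinuum.Crystallization.Cruxes.BarlowLiouville.Disproof

open Filter Set
open Literature.MathematicalPhysics.StatisticalMechanics Literature.Geometry.DiscreteGeometry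
open Summit.AtomisticToContinuum.Crystallization.Theses.DisclinationRation

/-! ## 1. Structure: the crux is `K4 → Core` -/

/-- `Core`: the crux with the `UniformPolytypeStability` antecedent removed — VERBATIM the rest of the
route decl `BarlowLiouville`. -/
def Core : Prop :=
  let GF : Set (EuclideanSpace ℝ (Fin 3)) → EuclideanSpace ℝ (Fin 3) → Prop := fun S y => let d : ℝ := sInf ((fun z => dist z y) '' (S \ {y})); let T : Set (EuclideanSpace ℝ (Fin 3)) := {z : EuclideanSpace ℝ (Fin 3) | z ∈ S ∧ z ≠ y ∧ dist z y < 13 / 10 * d}; ∃ A : EuclideanSpace ℝ (Fin 3) →ₗᵢ[ℝ] EuclideanSpace ℝ (Fin 3), (∃ e : ↥T ≃ ↥Literature.Geometry.DiscreteGeometry.fccKissingPattern, ∀ t : ↥T, dist (d⁻¹ • ((t : EuclideanSpace ℝ (Fin 3)) - y)) (A ((e t : ↥Literature.Geometry.DiscreteGeometry.fccKissingPattern) : EuclideanSpace ℝ (Fin 3))) ≤ 1 / 20) ∨ (∃ e : ↥T ≃ ↥Literature.Geometry.DiscreteGeometry.hcpKissingPattern, ∀ t : ↥T, dist (d⁻¹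 • ((t : EuclideanSpace ℝ (Fin 3)) - y)) (A ((e t : ↥Literature.Geometry.DiscreteGeometry.hcpKissingPattern) : EuclideanSpace ℝ (Fin 3))) ≤ 1 / 20); let HL : ((N : ℕ) → (Fin N → EuclideanSpace ℝ (Fin 3))) → Set (EuclideanSpace ℝ (Fin 3)) → Prop := fun x S => ∃ φ : ℕ → ℕ, StrictMono φ ∧ ∃ τ : ℕ → EuclideanSpace ℝ (Fin 3), ∀ R ε : ℝ, 0 < ε → ∀ᶠ j : ℕ in Filter.atTop, (∀ s ∈ S, ‖s‖ ≤ R → ∃ i : Fin (φ j), dist (x (φ j) i + τ j) s ≤ ε) ∧ (∀ i : Fin (φ j), ‖x (φ j) i + τ j‖ ≤ R → ∃ s ∈ S, dist (x (φ j) i + τ j) s ≤ ε); ∀ (x : (N : ℕ) → (Fin N → EuclideanSpace ℝ (Fin 3))), (∀ N, Literature.MathematicalPhysics.StatisticalMechanics.IsGroundState Literature.MathematicalPhysics.StatisticalMechanics.lennardJones (x N)) → ∀ δ : ℝ, 0 < δ → ∀ X : Set (EuclideanSpace ℝ (Fin 3)), (∀ y ∈ X, ∀ z ∈ X, y ≠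 z → δ ≤ dist y z) → HL x X → (∃ R₁ : ℝ, ∀ p : EuclideanSpace ℝ (Fin 3), ∃ y ∈ X, dist y p ≤ R₁) → (∀ y ∈ X, GF X y) → (∃ s : ℤ → ℤ, Literature.MathematicalPhysics.StatisticalMechanics.IsHaggSeq s ∧ ∃ Φ : EuclideanSpace ℝ (Fin 3) → EuclideanSpace ℝ (Fin 3), Set.BijOn Φ (Literature.MathematicalPhysics.StatisticalMechanics.barlowStacking 1 (Real.sqrt (2 / 3)) s) X ∧ ∀ p ∈ Literature.MathematicalPhysics.StatisticalMechanics.barlowStacking 1 (Real.sqrt (2 / 3)) s, ∃ A : EuclideanSpace ℝ (Fin 3) →ₗᵢ[ℝ] EuclideanSpace ℝ (Fin 3), ∃ l : ℝ, 0 < l ∧ ∀ q ∈ Literature.MathematicalPhysics.StatisticalMechanics.barlowStacking 1 (Real.sqrt (2 / 3)) s, dist q p ≤ 1 → dist (Φ q) (Φ p + l • A (q - p)) ≤ 1 / 20 * l) → (∃ a : ℝ, 47 / 50 ≤ a ∧ a ≤ 1 ∧ ∀ R ε : ℝ, 0 < ε → ∃ᶠ N in Filter.atTop, ∃ (A : EuclideanSpace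 ℝ (Fin 3) →ₗᵢ[ℝ] EuclideanSpace ℝ (Fin 3)) (t : EuclideanSpace ℝ (Fin 3)) (s : ℤ → ℤ) (z : ℤ → ℝ), Literature.MathematicalPhysics.StatisticalMechanics.IsHaggSeq s ∧ (∀ m : ℤ, 39 / 50 * a ≤ z (m + 1) - z m ∧ z (m + 1) - z m ≤ 17 / 20 * a) ∧ let S : Set (EuclideanSpace ℝ (Fin 3)) := {p | ∃ m i j : ℤ, p = A (((i : ℝ) • Literature.MathematicalPhysics.StatisticalMechanics.triangularVec₁ a) + ((j : ℝ) • Literature.MathematicalPhysics.StatisticalMechanics.triangularVec₂ a) + ((Literature.MathematicalPhysics.StatisticalMechanics.haggLabel s m : ℝ) • Literature.MathematicalPhysics.StatisticalMechanics.barlowOffset a) + (z m • Literature.MathematicalPhysics.StatisticalMechanics.layerNormal 1))}; (∀ p ∈ S, ‖p‖ ≤ R → ∃ i : Fin N, dist (x N i + t) p ≤ ε) ∧ (∀ i : Fin N, ‖x N i + t‖ ≤ R → ∃ p ∈ S, dist (x N i + t) p ≤ ε))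

/-- The crux IS `UniformPolytypeStability → Core` (definitional). [folklore] -/
theorem barlowLiouville_iff : BarlowLiouville ↔ (UniformPolytypeStability → Core) := Iff.rfl

/-- **What a refutation would have to do**: `¬ BarlowLiouville ↔ UniformPolytypeStability ∧ ¬ Core` — a
refuter must PROVE K4 and exhibit a ground-state sequence with a good templated hull element lacking
layered windows. [folklore] -/
theorem not_barlowLiouville_iff : ¬ BarlowLiouville ↔ (UniformPolytypeStability ∧ ¬ Core) := by
  rw [barlowLiouville_iff]
  tauto

/-- **Vacuity exit**: if K4 fails the crux holds trivially (the route then breaks at K4, not here).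
[folklore] -/
theorem barlowLiouville_of_not_stability (h : ¬ UniformPolytypeStability) : BarlowLiouville :=
  fun hK => absurd hK h

/-! ## 2. Load-bearing: the ground-state hypothesis (LANDED, p167480) -/

/-- `Core` with the ground-state hypothesis `∀ N, IsGroundState lennardJones (x N)` deleted, verbatim
otherwise. -/
def CoreWithoutGroundState : Prop :=
  let GF : Set (EuclideanSpace ℝ (Fin 3)) → EuclideanSpace ℝ (Fin 3) → Prop := fun S y => let d : ℝ := sInf ((fun z => dist z y) '' (S \ {y})); let T : Set (EuclideanSpace ℝ (Fin 3)) := {z : EuclideanSpace ℝ (Fin 3) | z ∈ S ∧ z ≠ y ∧ dist z y < 13 / 10 * d}; ∃ A : EuclideanSpace ℝ (Fin 3) →ₗᵢ[ℝ] EuclideanSpace ℝ (Fin 3), (∃ e : ↥T ≃ ↥Literature.Geometry.DiscreteGeometry.fccKissingPattern, ∀ t : ↥T, dist (d⁻¹ • ((t : EuclideanSpace ℝ (Fin 3)) - y)) (A ((e t : ↥Literature.Geometry.DiscreteGeometry.fccKissingPattern) : EuclideanSpace ℝ (Fin 3))) ≤ 1 / 20) ∨ (∃ e : ↥T ≃ ↥Literature.Geometry.DiscreteGeometry.hcpKissingPattern,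 ∀ t : ↥T, dist (d⁻¹ • ((t : EuclideanSpace ℝ (Fin 3)) - y)) (A ((e t : ↥Literature.Geometry.DiscreteGeometry.hcpKissingPattern) : EuclideanSpace ℝ (Fin 3))) ≤ 1 / 20); let HL : ((N : ℕ) → (Fin N → EuclideanSpace ℝ (Fin 3))) → Set (EuclideanSpace ℝ (Fin 3)) → Prop := fun x S => ∃ φ : ℕ → ℕ, StrictMono φ ∧ ∃ τ : ℕ → EuclideanSpace ℝ (Fin 3), ∀ R ε : ℝ, 0 < ε → ∀ᶠ j : ℕ in Filter.atTop, (∀ s ∈ S, ‖s‖ ≤ R → ∃ i : Fin (φ j), dist (x (φ j) i + τ j) s ≤ ε) ∧ (∀ i : Fin (φ j), ‖x (φ j) i + τ j‖ ≤ R → ∃ s ∈ S, dist (x (φ j) i + τ j) s ≤ ε); ∀ (x : (N : ℕ) → (Fin N → EuclideanSpace ℝ (Fin 3))), ∀ δ : ℝ, 0 < δ → ∀ X : Set (EuclideanSpace ℝ (Fin 3)), (∀ y ∈ X, ∀ z ∈ X, y ≠ z → δ ≤ dist y z) → HL x X → (∃ R₁ : ℝ, ∀ p : EuclideanSpace ℝ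 (Fin 3), ∃ y ∈ X, dist y p ≤ R₁) → (∀ y ∈ X, GF X y) → (∃ s : ℤ → ℤ, Literature.MathematicalPhysics.StatisticalMechanics.IsHaggSeq s ∧ ∃ Φ : EuclideanSpace ℝ (Fin 3) → EuclideanSpace ℝ (Fin 3), Set.BijOn Φ (Literature.MathematicalPhysics.StatisticalMechanics.barlowStacking 1 (Real.sqrt (2 / 3)) s) X ∧ ∀ p ∈ Literature.MathematicalPhysics.StatisticalMechanics.barlowStacking 1 (Real.sqrt (2 / 3)) s, ∃ A : EuclideanSpace ℝ (Fin 3) →ₗᵢ[ℝ] EuclideanSpace ℝ (Fin 3), ∃ l : ℝ, 0 < l ∧ ∀ q ∈ Literature.MathematicalPhysics.StatisticalMechanics.barlowStacking 1 (Real.sqrt (2 / 3)) s, dist q p ≤ 1 → dist (Φ q) (Φ p + l • A (q - p)) ≤ 1 / 20 * l) → (∃ a : ℝ, 47 / 50 ≤ a ∧ a ≤ 1 ∧ ∀ R ε : ℝ, 0 < ε → ∃ᶠ N in Filter.atTop, ∃ (A : EuclideanSpace ℝ (Fin 3) →ₗᵢ[ℝ] EuclideanSpace ℝ (Fin 3))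 (t : EuclideanSpace ℝ (Fin 3)) (s : ℤ → ℤ) (z : ℤ → ℝ), Literature.MathematicalPhysics.StatisticalMechanics.IsHaggSeq s ∧ (∀ m : ℤ, 39 / 50 * a ≤ z (m + 1) - z m ∧ z (m + 1) - z m ≤ 17 / 20 * a) ∧ let S : Set (EuclideanSpace ℝ (Fin 3)) := {p | ∃ m i j : ℤ, p = A (((i : ℝ) • Literature.MathematicalPhysics.StatisticalMechanics.triangularVec₁ a) + ((j : ℝ) • Literature.MathematicalPhysics.StatisticalMechanics.triangularVec₂ a) + ((Literature.MathematicalPhysics.StatisticalMechanics.haggLabel s m : ℝ) • Literature.MathematicalPhysics.StatisticalMechanics.barlowOffset a) + (z m • Literature.MathematicalPhysics.StatisticalMechanics.layerNormal 1))}; (∀ p ∈ S, ‖p‖ ≤ R → ∃ i : Fin N, dist (x N i + t) p ≤ ε) ∧ (∀ i : Fin N, ‖x N i + t‖ ≤ R → ∃ p ∈ S, dist (x N i + t) p ≤ ε))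

/-- The deleted-hypothesis form implies `Core` (so its failure is informative, not fatal). [folklore] -/
theorem core_of_coreWithoutGroundState (h : CoreWithoutGroundState) : Core :=
  fun x _ => h x

/-- **The ground-state hypothesis is load-bearing** — `CoreWithoutGroundState` is FALSE (the landed
`Theorems.BarlowLiouville.Negative.barlowLiouville_core_false_without_groundState`: enumerated fcc packing
of balls of diameter `2`). [folklore] -/
theorem core_false_without_groundState : ¬ CoreWithoutGroundState :=
  Summit.AtomisticToContinuum.Crystallization.Theorems.BarlowLiouville.Negative.barlowLiouville_core_false_without_groundState

/-! ## 3. The template hypothesis is redundant given the proved crux C -/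

/-- `Core` with the template hypothesis (the conclusion of `RobustBarlowTemplate`) deleted, verbatim
otherwise: a formally STRONGER statement. -/
def CoreNoTemplate : Prop :=
  let GF : Set (EuclideanSpace ℝ (Fin 3)) → EuclideanSpace ℝ (Fin 3) → Prop := fun S y => let d : ℝ := sInf ((fun z => dist z y) '' (S \ {y})); let T : Set (EuclideanSpace ℝ (Fin 3)) := {z : EuclideanSpace ℝ (Fin 3) | z ∈ S ∧ z ≠ y ∧ dist z y < 13 / 10 * d}; ∃ A : EuclideanSpace ℝ (Fin 3) →ₗᵢ[ℝ] EuclideanSpace ℝ (Fin 3), (∃ e : ↥T ≃ ↥Literature.Geometry.DiscreteGeometry.fccKissingPattern, ∀ t : ↥T, dist (d⁻¹ • ((t : EuclideanSpace ℝ (Fin 3)) - y)) (A ((e t : ↥Literature.Geometry.DiscreteGeometry.fccKissingPattern) : EuclideanSpace ℝ (Fin 3))) ≤ 1 / 20) ∨ (∃ e : ↥T ≃ ↥Literature.Geometry.DiscreteGeometry.hcpKissingPattern, ∀ t : ↥T, dist (d⁻¹ • ((t : EuclideanSpace ℝ (Fin 3)) - y)) (A ((e t : ↥Literature.Geometry.DiscreteGeometry.hcpKissingPattern)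 : EuclideanSpace ℝ (Fin 3))) ≤ 1 / 20); let HL : ((N : ℕ) → (Fin N → EuclideanSpace ℝ (Fin 3))) → Set (EuclideanSpace ℝ (Fin 3)) → Prop := fun x S => ∃ φ : ℕ → ℕ, StrictMono φ ∧ ∃ τ : ℕ → EuclideanSpace ℝ (Fin 3), ∀ R ε : ℝ, 0 < ε → ∀ᶠ j : ℕ in Filter.atTop, (∀ s ∈ S, ‖s‖ ≤ R → ∃ i : Fin (φ j), dist (x (φ j) i + τ j) s ≤ ε) ∧ (∀ i : Fin (φ j), ‖x (φ j) i + τ j‖ ≤ R → ∃ s ∈ S, dist (x (φ j) i + τ j) s ≤ ε); ∀ (x : (N : ℕ) → (Fin N → EuclideanSpace ℝ (Fin 3))), (∀ N, Literature.MathematicalPhysics.StatisticalMechanics.IsGroundState Literature.MathematicalPhysics.StatisticalMechanics.lennardJones (x N)) → ∀ δ : ℝ, 0 < δ → ∀ X : Set (EuclideanSpace ℝ (Fin 3)), (∀ y ∈ X, ∀ z ∈ X, y ≠ z → δ ≤ dist y z) → HL x X → (∃ R₁ : ℝ, ∀ p : EuclideanSpace ℝ (Fin 3), ∃ y ∈ X,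 dist y p ≤ R₁) → (∀ y ∈ X, GF X y) → (∃ a : ℝ, 47 / 50 ≤ a ∧ a ≤ 1 ∧ ∀ R ε : ℝ, 0 < ε → ∃ᶠ N in Filter.atTop, ∃ (A : EuclideanSpace ℝ (Fin 3) →ₗᵢ[ℝ] EuclideanSpace ℝ (Fin 3)) (t : EuclideanSpace ℝ (Fin 3)) (s : ℤ → ℤ) (z : ℤ → ℝ), Literature.MathematicalPhysics.StatisticalMechanics.IsHaggSeq s ∧ (∀ m : ℤ, 39 / 50 * a ≤ z (m + 1) - z m ∧ z (m + 1) - z m ≤ 17 / 20 * a) ∧ let S : Set (EuclideanSpace ℝ (Fin 3)) := {p | ∃ m i j : ℤ, p = A (((i : ℝ) • Literature.MathematicalPhysics.StatisticalMechanics.triangularVec₁ a) + ((j : ℝ) • Literature.MathematicalPhysics.StatisticalMechanics.triangularVec₂ a) + ((Literature.MathematicalPhysics.StatisticalMechanics.haggLabel s m : ℝ) • Literature.MathematicalPhysics.StatisticalMechanics.barlowOffset a) + (z m • Literature.MathematicalPhysics.StatisticalMechanics.layerNormal 1))}; (∀ p ∈ S, ‖p‖ ≤ R → ∃ i : Fin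 N, dist (x N i + t) p ≤ ε) ∧ (∀ i : Fin N, ‖x N i + t‖ ≤ R → ∃ p ∈ S, dist (x N i + t) p ≤ ε))

/-- **Given `RobustBarlowTemplate` (crux C, PROVED as item 12088), the template hypothesis of `Core` is
redundant**: `Core ↔ CoreNoTemplate`.  (`X ≠ ∅` comes from relative density.) [folklore] -/
theorem core_iff_noTemplate (hC : RobustBarlowTemplate) : Core ↔ CoreNoTemplate := by
  constructor
  · intro h x hx δ hδ X hsep hhull hdense hgood
    obtain ⟨R₁, hR₁⟩ := hdense
    obtain ⟨y₀, hy₀, -⟩ := hR₁ 0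
    exact h x hx δ hδ X hsep hhull ⟨R₁, hR₁⟩ hgood (hC δ hδ X ⟨y₀, hy₀⟩ hsep hgood)
  · intro h x hx δ hδ X hsep hhull hdense hgood _
    exact h x hx δ hδ X hsep hhull hdense hgood

end Summit.AtomisticToContinuum.Crystallization.Cruxes.BarlowLiouville.Disproof

end
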